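import Summits.Schanuel.Schanuel.Theorems.RootDecomp1KRadicalCells

/-!
# RootDecomp1K — «KUMMER CLOSURE» (lens 6 «DarkCarving/HyperCarving», gen 12 = 1K ROUND 9, THEOREM ROUND, PATH T)

Route `route-Schanuel-RootDecomp1K` (DRAFT rev 8) is UNCHANGED by this file: no item, no `closes` edit.  This is a
kernel-checked THEOREM file supporting crux A₄ʰ = `RootDecomp1K.HyperLiouvilleSchanuel` (stmt-Schanuel-33363).
It DECIDES the `n = 2, 3` line-cells `z = (λ, ρλ)` / `z = (λ, ρλ, w)` of A₄ʰ (ρ hyper-Liouville, `w` arbitrary) at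
EVERY anchor `λ ∈ 𝔏^× := exp⁻¹(ℚ̄^×)` whose exponential is NOT a root of unity — i.e. at every non-zero
determination of `log α` for every algebraic `α ∉ μ_∞ ∪ {0}` — modulo the REGISTERED Literature fact
`NesterenkoWaldschmidt1996_thm_1` ALONE (`hyperCell_log_any_of_NW1996Thm1`, `hyperLiouvilleSchanuel_live_at_logCell`).
Together with the tree's hypothesis-free TORSION cells (`hyperCell_ratPiI_any`: the anchors `λ ∈ ℚ^×·πi`, i.e.
`e^λ ∈ μ_∞`) this CLOSES the whole anchor class `𝔏 ∖ {0}` = {non-zero logarithms of algebraic numbers}: the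
«general Kummer closure ∀ α ∈ ℚ̄^× ∖ μ_∞» named ACCEPTED-NEXT (i‴) by the critic's round-9 VERDICT (2026-08-30T18:23:36Z)
— assembled in ONE kernel theorem `hyperCell_logAlg_any (hNW) : u ≠ 0 → e^u ∈ ℚ̄ → (cells at (u, ρu[, w]))`
(live text `hyperLiouvilleSchanuel_live_at_logAlgCell`).
Previously in the tree: only `λ ∈ ℚ^×·log 2` (gen 10 `hyperCell_ratLog2_any`) and the radical anchors of gen 11.

FLAGSHIP (`algebraicIndependent_log_rpow`): mod NW96 Thm 1, for every algebraic `α ≠ 0` not a root of unity,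
every `λ` with `e^λ = α` and every hyper-Liouville real `ρ > 0`, the numbers `ρ, λ, α^ρ := e^{λρ}` are
algebraically independent over `ℚ` (real form `algebraicIndependent_real_log_rpow`: `ρ, log a, a^ρ` for real
algebraic `a > 0`, `a ≠ 1`).  Gelfond–Schneider gives only `trdeg ≥ 1` here; Schanuel predicts 3; we get 3 on the
hyper-Liouville fibre.

## THE NEW LEMMA (the creditable content named by the VERDICT): the UNIFORM KUMMER DEGREE BOUND (§K1)

`kummer_degree_uniform`: for `α ∈ ℚ̄^×` not a root of unity there is `c = c(α) > 0` such that for ALL coprime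
`(p, q)`, `q ≥ 1`, and EVERY `η` with `η^q = α^p`, every non-zero `g ∈ ℤ[X]` with `g(η) = 0` has
`deg g ≥ c·q` — i.e. `[ℚ(α^{p/q}) : ℚ] ≥ c(α)·q` UNIFORMLY IN `p` (kernel-checked, elementary).  Mechanism:
in `K = ℚ(α)` let `e = [K(η) : K]`; the `K(η)/K`-norm `β₀` of `η` satisfies `β₀^q = α^{pe}`, and Bézout
(`pp' = qk + 1`) turns it into `β = β₀^{p'}/α^{ek} ∈ K` with `β^q = α^e` (`exists_pow_eq_pow_finrank`).  If `a`
is a denominator of `α` then `aβ` is an algebraic INTEGER of `K` all of whose conjugates are `≤ |a|·house(α)`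
(as `|φ(β)| = |φ(α)|^{e/q} ≤ house(α)` when `e ≤ q`), so `aβ` lies in the FINITE set
`NumberField.Embeddings.finite_of_norm_le K ℂ (|a|·house α)`; a non-torsion `α` pins the ratio `e/q` attached to each
member of that set (`α^{e q'} = α^{e' q}` ⇒ `eq' = e'q`, `pow_injective_of_not_torsion`), whence `e/q ≥ c₀(α) > 0`
over the finite set, and `deg_ℚ η ≥ e ≥ c q`.  The bound is then made uniform over the CONJUGATES of `α`
(`kummer_degree_conj`, a finite minimum).  This is exactly the input the gen-10 engine had only for `α = 2`
(`X^q − 2^p` Eisenstein/irreducible, degree `= q`) and that NO base swap supplies for a general `α`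
(`X^q − α^p` is reducible in general, e.g. `α = 4`, `q = 2`).

## THE ENGINE (§K5, `logCell_aeval_ne_zero`) — ONE relation `P(ρ, λ, e^{λρ}) = 0` is impossible

Substitute the hyper-Liouville approximants `r = p/q → ρ` (`|ρ − r| < e^{−q^m}`, `m = 2τ+7`): `P(r, λ, e^{λr})` is
`e^{−q^m}`-close to `0` (Lipschitz, the tree's `linF`), and `w = e^{λ r}` is a root of the NORM POLYNOMIAL
`E_{p,q}(X) = Res_z(A_α(z), X^q − z^p) = lc(A)^p ∏_{A(z)=0} (X^q − z^p) ∈ ℤ[X]` (§K3 `normPoly`, via the tree's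
`resPoly`; degree `≤ nq`, Mahler measure `≤ 2^n M(α)^p`).  Eliminating `w` against `E_{p,q}` (tree `resPoly`/`torG`
of gen 10) yields `S ∈ ℤ[X]∖0` with `S(λ)` TOO SMALL for a finite transcendence type of `λ`, PROVIDED no conjugate
factor `G_b(T) = q^D P(p/q, T, b)` (`b` a root of `E_{p,q}`, i.e. `b^q = z^p` for a conjugate `z` of `α`) vanishes
identically — and THAT is where the uniform degree bound enters (`conjFactor_torG_ne_zero_of_degree`): a vanishing
`G_b` puts `b` in a field of degree `≤ deg_W P < c(α) q`, contradicting `[ℚ(b):ℚ] ≥ c(α) q` for `q` large.  The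
finite transcendence type of `λ = log α` is derived in §K6 from NW96 Thm 1 with `β = ξ`, `|e^θ − α| = 0`
(`finiteTranscendenceType_log`, `τ = 6`; also in one screen from `W78LogMeasure`, `τ = 4`).

## Dictionary of sections
* §K1 `pow_injective_of_not_torsion`, `exists_pow_eq_pow_finrank`, `kummer_degree_uniform` — the new lemma.
* §K2 conjugates: `root_ne_zero_not_torsion`, `kummer_degree_conj`.
* §K3 `kumG`, `normPoly` (+ `aeval_normPoly`, `mem_roots_normPoly`, `natDegree_normPoly_le`, `mahlerMeasure_normPoly_le`).
* §K4 four one-line twins of tree-private real lemmas.  NO COPIES: the gen-11 port (`RootDecomp1KRadical01–05`,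
  `RootDecomp1KRadicalCells`, landed 2026-08-30 18:59–19:18Z) is IMPORTED and its `FiniteTranscendenceType`
  (+ `.transcendental`), `sum_abs_coeff_le`, `linF` (+ `linF_eq_aeval`, `exists_lipschitz_linF`), `type_exponent_le`,
  `endgame_type`, `eta_lt_exp_neg_pow_of_le`, `hyperCell_radical_any` are USED BY NAME, as is everything of the
  gen-10 port (`resPoly`, `torG`, `relLen_torG_le`, `norm_mvaeval_le`, `upper_exp`, `eta_lt_delta`,
  `norm_multiset_map_prod_le`, `HyperLiouville.ne_zero/neg/rat_mul`, `hyperCell_ratPiI_any`, …).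
* §K5 the engine `logCell_aeval_ne_zero` / `algebraicIndependent_logCell` (hypotheses: `e^λ = α` algebraic
  non-torsion, `FiniteTranscendenceType λ`, `ρ > 0` hyper-Liouville).  GEN-13 RE-CUT (v2, census NOTE
  2026-08-30T19:37:09Z, the gate's 400-line file rule): the 466-line engine proof of v1 is now assembled from
  `engine_lower` (L: the type inequality on the eliminant, 140 l) and `engine_upper` (U: the product over the
  roots of the norm polynomial, 94 l) plus the helpers `norm_le_exp_of_pow_eq_pow`, `cexp_mul_ratCast_pow`; the
  engine itself is 262 l; every STATEMENT of v1 is unchanged (v1 sha256 6d5e0790…, v2 = this file).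
* §K6 `finiteTranscendenceType_log` (mod NW96 Thm 1; `lphi`, `log_approx`, `log_measure`, `log_exponent_le`) and
  `finiteTranscendenceType_log_of_W78` (mod `W78LogMeasure`).
* §K7 cells `hyperCell_log_any` (FTT-provider form), `…_of_NW1996Thm1`, `…_of_W78`, live forms, the closure
  `hyperCell_logAlg_any` (all `u ∈ 𝔏 ∖ {0}`), flagship; by-product `hyperCell_loglog_any` (the gen-11 RADICAL cells
  on every line `ℂ·u` with `e^{e^u} ∈ ℚ̄`, i.e. anchors `log log α`, fed by `finiteTranscendenceType_log`).

LIMITS (honest): `ρ` real (as in all line-cells of this route); `e^λ` non-torsion (torsion anchors are the tree's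
torsion cells); nothing here proves Schanuel or A₄ʰ in general — rung 0, `--supports stmt-Schanuel-33363`.
Sorry-free; standard axioms only (facts enter as hypotheses `hNW` / `hlm` / `hFT`).
-/

open Polynomial Complex IntermediateField
open Summit.Schanuel.Schanuel.Theorems.RootDecomp1KHyper
open Summit.Schanuel.Schanuel.Theorems.RootDecomp1KHyper.HyperCell
open Summit.Schanuel.Schanuel.Theorems.RootDecomp1KRadical

noncomputable section

namespace Summit.Schanuel.Schanuel.Theorems.RootDecomp1KKummerClosure

/-! ## K1. The uniform Kummer degree bound `[ℚ(α^{p/q}) : ℚ] ≥ c(α) q` -/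

section KummerDegree

/-- Exponent injectivity for a non-zero non-torsion element. -/
theorem pow_injective_of_not_torsion {F : Type*} [Field F] {a : F} (ha0 : a ≠ 0)
    (htor : ∀ n : ℕ, 0 < n → a ^ n ≠ 1) {m n : ℕ} (h : a ^ m = a ^ n) : m = n := by
  by_contra hne
  rcases Nat.lt_or_gt_of_ne hne with hlt | hlt
  · have e : a ^ n = a ^ m * a ^ (n - m) := by rw [← pow_add, Nat.add_sub_cancel' hlt.le]
    have h1 : a ^ m * 1 = a ^ m * a ^ (n - m) := by rw [mul_one, ← e, h]
    exact htor (n - m) (Nat.sub_pos_of_lt hlt) (mul_left_cancel₀ (pow_ne_zero m ha0) h1).symm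
  · have e : a ^ m = a ^ n * a ^ (m - n) := by rw [← pow_add, Nat.add_sub_cancel' hlt.le]
    have h1 : a ^ n * 1 = a ^ n * a ^ (m - n) := by rw [mul_one, ← e, h]
    exact htor (m - n) (Nat.sub_pos_of_lt hlt) (mul_left_cancel₀ (pow_ne_zero n ha0) h1).symm

/-- In `K = ℚ(α)`, for `η` with `η^q = α^p`, `gcd(p,q) = 1`: some `β ∈ K` has `β^q = α^e`,
`e = [K(η) : K]` (the norm of `η` from `K(η)` to `K`, followed by Bézout). -/
theorem exists_pow_eq_pow_finrank {K : IntermediateField ℚ ℂ} {α' : K} (hα'0 : α' ≠ 0)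
    {p q : ℕ} (hq : 0 < q) (hpq : p.Coprime q) {η : ℂ} (hη : η ^ q = (α' : ℂ) ^ p)
    (hηint : IsIntegral K η) :
    ∃ β : K, β ^ q = α' ^ (minpoly K η).natDegree := by
  set e := (minpoly K η).natDegree with he_def
  have hfr : Module.finrank K K⟮η⟯ = e := adjoin.finrank hηint
  set gen := AdjoinSimple.gen K η with hgen_def
  have hgen : gen ^ q = algebraMap K K⟮η⟯ (α' ^ p) := by
    apply Subtype.ext
    rw [IntermediateField.coe_pow, AdjoinSimple.coe_gen, hη, coe_algebraMap_apply, map_pow,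
      IntermediateField.algebraMap_apply]
  set β₀ : K := Algebra.norm K gen with hβ₀_def
  have hβ₀ : β₀ ^ q = α' ^ (p * e) := by
    rw [hβ₀_def, ← map_pow, hgen, Algebra.norm_algebraMap, hfr, ← pow_mul]
  rcases Nat.lt_or_ge 1 q with hq1 | hq1
  · obtain ⟨p', -, hp'⟩ := Nat.exists_mul_mod_eq_one_of_coprime hpq hq1
    set k := p * p' / q with hk
    have hbez : p * p' = q * k + 1 := by
      have := Nat.div_add_mod (p * p') q; rw [hp'] at this; exact this.symm
    refine ⟨β₀ ^ p' / α' ^ (e * k), ?_⟩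
    have hnum : (β₀ ^ p') ^ q = α' ^ (e * k * q) * α' ^ e := by
      rw [← pow_mul, mul_comm p' q, pow_mul, hβ₀, ← pow_mul, ← pow_add]
      congr 1
      calc p * e * p' = e * (p * p') := by ring
        _ = e * (q * k + 1) := by rw [hbez]
        _ = e * k * q + e := by ring
    rw [div_pow, hnum, ← pow_mul, mul_div_cancel_left₀ _ (pow_ne_zero _ hα'0)]
  · have hq' : q = 1 := by omega
    exact ⟨α' ^ e, by rw [hq', pow_one]⟩

/-- **The uniform Kummer degree bound.** For `α ∈ ℚ̄`, `α ≠ 0`, `α` not a root of unity there is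
`c = c(α) > 0` with: for all coprime `p, q ≥ 1`... (`q ≥ 1`, any `p` coprime to `q`) and every `η`
with `η^q = α^p`, every non-zero integer polynomial vanishing at `η` has degree `≥ c q` — i.e.
`[ℚ(η) : ℚ] ≥ c q`, UNIFORMLY in `p`.  (Elementary: norms to `K = ℚ(α)`, Bézout, and the finiteness
of the algebraic integers of `K` with bounded house — `NumberField.Embeddings.finite_of_norm_le`.) -/
theorem kummer_degree_uniform {α : ℂ} (hα : IsAlgebraic ℚ α) (hα0 : α ≠ 0)
    (htor : ∀ n : ℕ, 0 < n → α ^ n ≠ 1) :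
    ∃ c : ℝ, 0 < c ∧ ∀ (p q : ℕ) (η : ℂ), 0 < q → p.Coprime q → η ^ q = α ^ p →
      ∀ g : ℤ[X], g ≠ 0 → aeval η g = 0 → c * q ≤ (g.natDegree : ℝ) := by
  classical
  have hαint : IsIntegral ℚ α := isAlgebraic_iff_isIntegral.mp hα
  set K : IntermediateField ℚ ℂ := ℚ⟮α⟯ with hK
  haveI : FiniteDimensional ℚ K := adjoin.finiteDimensional hαint
  haveI : NumberField K := NumberField.mk
  set α' : K := AdjoinSimple.gen ℚ α with hα'_def
  have hα' : (α' : ℂ) = α := AdjoinSimple.coe_gen ℚ α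
  have hα'0 : α' ≠ 0 := by
    intro h; apply hα0; rw [← hα', h]; rfl
  have htor' : ∀ n : ℕ, 0 < n → α' ^ n ≠ 1 := by
    intro n hn h
    apply htor n hn
    have := congrArg (fun x : K => (x : ℂ)) h
    simpa [IntermediateField.coe_pow, hα'] using this
  -- a denominator for `α'`
  have hα'int : IsIntegral ℚ α' := IntermediateField.isIntegral_iff.mpr (by rw [hα']; exact hαint)
  have hα'alg : IsAlgebraic ℤ α' := (IsFractionRing.isAlgebraic_iff ℤ ℚ K).mpr hα'int.isAlgebraic
  obtain ⟨a, ha0, haint⟩ := hα'alg.exists_integral_multiple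
  have haint' : IsIntegral ℤ ((a : K) * α') := by
    have e : (a : K) * α' = a • α' := (zsmul_eq_mul α' a).symm
    rw [e]; exact haint
  -- a bound for the conjugates of `α`
  set Aα : ℝ := ∑ φ : K →+* ℂ, ‖φ α'‖ + 1 with hAα_def
  have hφα : ∀ φ : K →+* ℂ, ‖φ α'‖ ≤ Aα := by
    intro φ
    have := Finset.single_le_sum (f := fun ψ : K →+* ℂ => ‖ψ α'‖) (fun ψ _ => norm_nonneg _)
      (Finset.mem_univ φ)
    exact this.trans (by linarith)
  have hAα1 : 1 ≤ Aα := by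
    have := Finset.sum_nonneg (s := Finset.univ) (f := fun ψ : K →+* ℂ => ‖ψ α'‖)
      (fun ψ _ => norm_nonneg _)
    linarith
  -- the finite set of candidates `a β'`
  set B : ℝ := |(a : ℝ)| * Aα with hB_def
  have hfin := NumberField.Embeddings.finite_of_norm_le K ℂ B
  set F : Finset K := hfin.toFinset with hF_def
  -- the ratio `e/q` attached to a candidate
  set rel : K → ℕ × ℕ → Prop := fun x qe =>
    (0 < qe.1 ∧ 0 < qe.2) ∧ x ^ qe.1 = (a : K) ^ qe.1 * α' ^ qe.2 with hrel_def
  set ratio : K → ℝ := fun x =>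
    if h : ∃ qe, rel x qe then (h.choose.2 : ℝ) / h.choose.1 else 1 with hratio_def
  have hratio_pos : ∀ x, 0 < ratio x := by
    intro x
    simp only [hratio_def]
    split_ifs with h
    · obtain ⟨⟨h1, h2⟩, -⟩ := h.choose_spec
      exact div_pos (by exact_mod_cast h2) (by exact_mod_cast h1)
    · exact one_pos
  have hne : (insert (1 : ℝ) (F.image ratio)).Nonempty := Finset.insert_nonempty _ _
  set c : ℝ := (insert (1 : ℝ) (F.image ratio)).min' hne with hc_def
  have hc1 : c ≤ 1 := Finset.min'_le _ _ (Finset.mem_insert_self _ _)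
  have hcF : ∀ x ∈ F, c ≤ ratio x := fun x hx =>
    Finset.min'_le _ _ (Finset.mem_insert_of_mem (Finset.mem_image_of_mem _ hx))
  have hc0 : 0 < c := by
    have hmem := Finset.min'_mem (insert (1 : ℝ) (F.image ratio)) hne
    rcases Finset.mem_insert.mp hmem with h | h
    · rw [hc_def, h]; exact one_pos
    · obtain ⟨x, -, hx⟩ := Finset.mem_image.mp h
      rw [hc_def, ← hx]; exact hratio_pos x
  refine ⟨c, hc0, ?_⟩
  intro p q η hq hpq hη g hg0 hgη
  -- `η` is integral over `K`, of degree `e ≤ deg g`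
  have hηint : IsIntegral K η := by
    refine ⟨X ^ q - C (α' ^ p), monic_X_pow_sub_C _ hq.ne', ?_⟩
    simp [hη, hα']
  set e := (minpoly K η).natDegree with he_def
  have he_pos : 0 < e := minpoly.natDegree_pos hηint
  have he_le : e ≤ g.natDegree := by
    have hg' : g.map (algebraMap ℤ K) ≠ 0 := by
      rwa [Ne, Polynomial.map_eq_zero_iff (FaithfulSMul.algebraMap_injective ℤ K)]
    have hgη' : aeval η (g.map (algebraMap ℤ K)) = 0 := by rwa [aeval_map_algebraMap]
    have h1 := minpoly.degree_le_of_ne_zero K η hg' hgη'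
    have h2 : (minpoly K η).natDegree ≤ (g.map (algebraMap ℤ K)).natDegree :=
      natDegree_le_natDegree h1
    rwa [natDegree_map_eq_of_injective (FaithfulSMul.algebraMap_injective ℤ K)] at h2
  by_cases hqe : q ≤ e
  · calc c * q ≤ 1 * q := by gcongr
      _ = q := one_mul _
      _ ≤ e := by exact_mod_cast hqe
      _ ≤ g.natDegree := by exact_mod_cast he_le
  push Not at hqe
  -- `β' ∈ K` with `β'^q = α'^e`, and the candidate `x = a β'`
  have hη' : η ^ q = (α' : ℂ) ^ p := by rw [hα', hη]
  obtain ⟨β', hβ'⟩ := exists_pow_eq_pow_finrank hα'0 hq hpq hη' hηint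
  set x : K := (a : K) * β' with hx_def
  have hxq : x ^ q = (a : K) ^ q * α' ^ e := by rw [hx_def, mul_pow, hβ']
  have hxint : IsIntegral ℤ x := by
    refine IsIntegral.of_pow hq ?_
    have e1 : x ^ q = (a : K) ^ (q - e) * ((a : K) * α') ^ e := by
      rw [hxq, mul_pow, ← mul_assoc, ← pow_add, Nat.sub_add_cancel hqe.le]
    rw [e1]
    exact ((isIntegral_algebraMap (R := ℤ) (x := a)).pow _).mul (haint'.pow _)
  have hxnorm : ∀ φ : K →+* ℂ, ‖φ x‖ ≤ B := by
    intro φ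
    have h1 : ‖φ x‖ ^ q = |(a : ℝ)| ^ q * ‖φ α'‖ ^ e := by
      rw [← norm_pow, ← map_pow, hxq, map_mul, map_pow, map_pow, norm_mul, norm_pow, norm_pow,
        map_intCast, Complex.norm_intCast]
    have h2 : ‖φ x‖ ^ q ≤ B ^ q := by
      rw [h1, hB_def, mul_pow]
      have h3 : ‖φ α'‖ ^ e ≤ Aα ^ q :=
        (pow_le_pow_left₀ (norm_nonneg _) (hφα φ) e).trans (pow_le_pow_right₀ hAα1 hqe.le)
      exact mul_le_mul_of_nonneg_left h3 (by positivity)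
    exact le_of_pow_le_pow_left₀ hq.ne' (by positivity) h2
  have hxF : x ∈ F := by
    rw [hF_def, Set.Finite.mem_toFinset]
    exact ⟨hxint, hxnorm⟩
  -- its ratio is `e/q`
  have hrelx : ∃ qe, rel x qe := ⟨(q, e), ⟨hq, he_pos⟩, hxq⟩
  have ha0K : (a : K) ≠ 0 := by exact_mod_cast ha0
  have hrx : ratio x = (e : ℝ) / q := by
    simp only [hratio_def, dif_pos hrelx]
    obtain ⟨⟨hq₀, he₀⟩, hx₀⟩ := hrelx.choose_spec
    have key : α' ^ (hrelx.choose.2 * q) = α' ^ (e * hrelx.choose.1) := by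
      have h1 : x ^ (hrelx.choose.1 * q) = (a : K) ^ (hrelx.choose.1 * q) * α' ^ (hrelx.choose.2 * q) := by
        rw [pow_mul, hx₀, mul_pow, ← pow_mul, ← pow_mul]
      have h2 : x ^ (hrelx.choose.1 * q) = (a : K) ^ (hrelx.choose.1 * q) * α' ^ (e * hrelx.choose.1) := by
        rw [mul_comm hrelx.choose.1 q, pow_mul, hxq, mul_pow, ← pow_mul, ← pow_mul]
      exact mul_left_cancel₀ (pow_ne_zero _ ha0K) (h1.symm.trans h2)
    have heq := pow_injective_of_not_torsion hα'0 htor' key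
    rw [div_eq_div_iff (by exact_mod_cast hq₀.ne') (by exact_mod_cast hq.ne')]
    exact_mod_cast heq
  have hcx := hcF x hxF
  rw [hrx, le_div_iff₀ (by exact_mod_cast hq)] at hcx
  calc c * q ≤ e := hcx
    _ ≤ g.natDegree := by exact_mod_cast he_le

end KummerDegree

/-! ## K2. Conjugates of `α`: root facts for an irreducible integer polynomial and the uniform constant -/

section Conjugates

/-- §K2. A root of `A.map (Int.castRingHom ℂ)` is a zero of `aeval · A`. -/
theorem aeval_of_mem_roots_map {A : ℤ[X]} {z : ℂ} (hz : z ∈ (A.map (Int.castRingHom ℂ)).roots) :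
    aeval z A = 0 := by
  by_cases hA : A = 0
  · simp [hA]
  rw [mem_roots ((Polynomial.map_ne_zero_iff (RingHom.injective_int _)).mpr hA), IsRoot.def,
    eval_map, ← algebraMap_int_eq, ← aeval_def] at hz
  exact hz

/-- §K2. Conversely, a complex zero of `A ≠ 0` lies in the root multiset of `A.map (Int.castRingHom ℂ)`. -/
theorem mem_roots_map_of_aeval {A : ℤ[X]} (hA : A ≠ 0) {z : ℂ} (hz : aeval z A = 0) :
    z ∈ (A.map (Int.castRingHom ℂ)).roots := by
  rw [mem_roots ((Polynomial.map_ne_zero_iff (RingHom.injective_int _)).mpr hA), IsRoot.def,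
    eval_map, ← algebraMap_int_eq, ← aeval_def]
  exact hz

/-- The roots of an irreducible `A ∈ ℤ[X]` one of whose roots `α` is non-zero and non-torsion are all
non-zero and non-torsion (Gauss: `A` divides every integer polynomial vanishing at one of its roots). -/
theorem root_ne_zero_not_torsion {A : ℤ[X]} (hA : Irreducible A) (hAd : 0 < A.natDegree) {α : ℂ}
    (hAα : aeval α A = 0) (hα0 : α ≠ 0) (htor : ∀ n : ℕ, 0 < n → α ^ n ≠ 1) {z : ℂ}
    (hz : aeval z A = 0) : z ≠ 0 ∧ ∀ n : ℕ, 0 < n → z ^ n ≠ 1 := by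
  constructor
  · rintro rfl
    have h1 : aeval (0 : ℂ) (X : ℤ[X]) = 0 := by simp
    obtain ⟨T, hT⟩ := dvd_of_irreducible_of_common_root hA hAd hz h1
    have : aeval α (X : ℤ[X]) = 0 := by rw [hT, map_mul, hAα, zero_mul]
    exact hα0 (by simpa using this)
  · intro n hn hzn
    have h1 : aeval z (X ^ n - 1 : ℤ[X]) = 0 := by simp [hzn]
    obtain ⟨T, hT⟩ := dvd_of_irreducible_of_common_root hA hAd hz h1
    have : aeval α (X ^ n - 1 : ℤ[X]) = 0 := by rw [hT, map_mul, hAα, zero_mul]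
    exact htor n hn (by simpa [sub_eq_zero] using this)

/-- a positive constant that works for every member of a finite family (for antitone predicates) -/
theorem exists_pos_forall_of_finset {ι : Type*} [DecidableEq ι] (s : Finset ι) (P : ι → ℝ → Prop)
    (hmono : ∀ i c c', 0 < c' → c' ≤ c → P i c → P i c')
    (h : ∀ i ∈ s, ∃ c : ℝ, 0 < c ∧ P i c) : ∃ c : ℝ, 0 < c ∧ ∀ i ∈ s, P i c := by
  induction s using Finset.induction_on with
  | empty => exact ⟨1, one_pos, by simp⟩
  | insert a s ha ih =>
    obtain ⟨c₁, hc₁, h₁⟩ := h a (Finset.mem_insert_self a s)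
    obtain ⟨c₂, hc₂, h₂⟩ := ih fun i hi => h i (Finset.mem_insert_of_mem hi)
    refine ⟨min c₁ c₂, lt_min hc₁ hc₂, fun i hi => ?_⟩
    rcases Finset.mem_insert.mp hi with rfl | hi
    · exact hmono _ _ _ (lt_min hc₁ hc₂) (min_le_left _ _) h₁
    · exact hmono _ _ _ (lt_min hc₁ hc₂) (min_le_right _ _) (h₂ i hi)

/-- **The uniform Kummer degree bound over all conjugates.**  `A ∈ ℤ[X]` irreducible with the root
`α ≠ 0` non-torsion: ONE `c = c(A) > 0` with `[ℚ(η):ℚ] ≥ c q` for every `η`, `η^q = z^p`, `z` ANY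
complex root of `A`, `gcd(p, q) = 1`. -/
theorem kummer_degree_conj {A : ℤ[X]} (hA : Irreducible A) (hAd : 0 < A.natDegree) {α : ℂ}
    (hAα : aeval α A = 0) (hα0 : α ≠ 0) (htor : ∀ n : ℕ, 0 < n → α ^ n ≠ 1) :
    ∃ c : ℝ, 0 < c ∧ ∀ z ∈ (A.map (Int.castRingHom ℂ)).roots, ∀ (p q : ℕ) (η : ℂ), 0 < q →
      p.Coprime q → η ^ q = z ^ p →
      ∀ g : ℤ[X], g ≠ 0 → aeval η g = 0 → c * q ≤ (g.natDegree : ℝ) := by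
  classical
  have hA0 : A ≠ 0 := hA.ne_zero
  obtain ⟨c, hc, h⟩ := exists_pos_forall_of_finset (A.map (Int.castRingHom ℂ)).roots.toFinset
    (fun z c => ∀ (p q : ℕ) (η : ℂ), 0 < q → p.Coprime q → η ^ q = z ^ p →
      ∀ g : ℤ[X], g ≠ 0 → aeval η g = 0 → c * q ≤ (g.natDegree : ℝ))
    (fun z c c' hc' hle hP p q η hq hpq hη g hg hgη =>
      (mul_le_mul_of_nonneg_right hle (Nat.cast_nonneg q)).trans (hP p q η hq hpq hη g hg hgη))
    (fun z hz => by
      have hzA := aeval_of_mem_roots_map (Multiset.mem_toFinset.mp hz)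
      obtain ⟨hz0, hztor⟩ := root_ne_zero_not_torsion hA hAd hAα hα0 htor hzA
      exact kummer_degree_uniform (isAlgebraic_of_aeval_int hA0 hzA) hz0 hztor)
  exact ⟨c, hc, fun z hz => h z (Multiset.mem_toFinset.mpr hz)⟩

end Conjugates

end Summit.Schanuel.Schanuel.Theorems.RootDecomp1KKummerClosure
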